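import Summits.Ventures.PercRepro.S2ThirteenSevenSpreadThree
import Summits.Ventures.PercRepro.S2FourTriangleTopEighteen
import Summits.Ventures.PercRepro.TriangleCapEightI
import Summits.Ventures.PercRepro.S1FiveCircuitBase

/-!
# PercRepro — S2: THE TWICE-SCALED CELL `(11, 7)` OF `(13, 7)` AT `K₂ = 12107` — THE SPREAD ROWS `t ≤ 8` (p7, gen 17)

The second coloop step of the cell `(13, 7)`: on `(M ＼ {e}) ＼ {f}` (an `e`-free core of rank `11` on `18` points, coloops allowed,
the standard caps `11 / 69 / 401` — `caps_eleven_seven`) the weighted inequality `(Φ(13, 5) − 6)/4 · #U(11, 5) ≤ mid(11, 5)`.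
THE SPREAD CASE (no set of nullity `4` on `≤ 9` points): the rows `t ≤ 2` by the independent `5`-sets, the plain top-`6` charge
`455·t + 91·69 + 13·401 + 924` and the kit's spanning count (`U ≤ 27015` against `29321`, `m = 404`); the rows `3 ≤ t ≤ 8` by the
three-triangle spanning Bonferroni (`S ≤ 48847`) and, at `t ≥ 4`, the four-triangle count `U₅ ≤ 7728`
(`S2.ncard_top_five_le_of_four_triangles_eighteen`): `U ≤ 30206` against `31024` (`m = 368`; ratios `0.87 … 0.97`).
**`c025_eleven_seven_k2_spread_le_two`**, **`c025_eleven_seven_k2_spread_three_to_eight`**. Nothing about any cell is claimed.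
Axioms: standard.
-/

open scoped Matroid

namespace PercRepro

namespace ThmN

open Set

variable {α : Type}

/-- The standard caps at `(11, 7)`: `s₃ ≤ 11`, `s₄ ≤ 69`, `s₅ ≤ 401` on every `e`-free core of nullity `7` (coloops allowed). -/
theorem caps_eleven_seven (M : Matroid α) [M.Finite]
    (hd : M.E.encard = M.eRank + ((7 : ℕ) : ℕ∞))
    (hfree : ∀ e ∈ M.E, ∃ A ⊆ M.E \ {e}, e ∉ M.closure A ∧ e ∉ M.closure ((M.E \ {e}) \ A)) :
    {C : Set α | M.IsCircuit C ∧ C.ncard = 3}.ncard ≤ 11 ∧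
      {C : Set α | M.IsCircuit C ∧ C.ncard = 4}.ncard ≤ 69 ∧
        {C : Set α | M.IsCircuit C ∧ C.ncard = 5}.ncard ≤ 401 := by
  have hs3 := TriangleCap.core_ncard_triangles_le_cq3 M hfree hd
  rw [show TriangleCap.cq3 7 = 11 by decide] at hs3
  have hs4 := ncard_fourCircuits_le_avgChain16 7 M hfree hd
  rw [show avgChain16 7 = 69 by decide] at hs4
  have hs5 := S1.ncard_fiveCircuits_le_avgChain5b 7 M hfree hd
  rw [show S1.avgChain5b 7 = 401 by decide] at hs5
  exact ⟨hs3, hs4, hs5⟩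

/-- **The rows `t ≤ 2` of the spread case of the twice-scaled cell `(11, 7)` at `K₂`.** -/
theorem c025_eleven_seven_k2_spread_le_two (M : Matroid α) [M.Finite]
    (hR : M.eRank = ((11 : ℕ) : ℕ∞)) (hn : M.E.ncard = 11 + 7)
    (hfree : ∀ e ∈ M.E, ∃ A ⊆ M.E \ {e}, e ∉ M.closure A ∧ e ∉ M.closure ((M.E \ {e}) \ A))
    (h4 : ¬ ∃ W ⊆ M.E, W.ncard ≤ 9 ∧ W.encard = M.eRk W + 4)
    (ht2 : {C : Set α | M.IsCircuit C ∧ C.ncard = 3}.ncard ≤ 2) :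
    ((phiK 13 5 - 6) / 4) * (Matroid.topCount M 11 5 : ℚ) ≤ (Matroid.midCount M 11 5 : ℚ) := by
  classical
  have hd : M.E.encard = M.eRank + ((7 : ℕ) : ℕ∞) := by
    rw [hR, ← M.ground_finite.cast_ncard_eq, hn]
    push_cast
    ring
  obtain ⟨-, hs4c, hs5⟩ := caps_eleven_seven M hd hfree
  have hflat : ∀ X ⊆ M.E, M.eRk X ≤ 5 → X.ncard ≤ 8 := fun X hX hr => by
    have := S2.ncard_le_of_eRk_le_of_not_nullity M 4 9 (by norm_num) h4 hX (r := 5) (by norm_num) (by exact_mod_cast hr)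
    omega
  have hflat' : ∀ X ⊆ M.E, M.eRk X ≤ 4 → X.ncard ≤ 7 := fun X hX hr => by
    have := S2.ncard_le_of_eRk_le_of_not_nullity M 4 9 (by norm_num) h4 hX (r := 4) (by norm_num) (by exact_mod_cast hr)
    omega
  have hEcard : M.ground_finite.toFinset.card = 11 + 7 := by
    rw [← Set.ncard_eq_toFinset_card _ M.ground_finite]; exact hn
  have hL0 : ∀ e ∈ M.E, ¬ M.IsLoop e := not_isLoop_of_free M hfree
  have hs : ∀ e ∈ M.E, ∀ f ∈ M.E, e ≠ f → M.eRk {e, f} = 2 := by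
    intro e he f hf hef
    have h2 : (2 : ℕ∞) ≤ M.eRk {e, f} :=
      two_le_eRk_of_two_le_ncard_of_free M hfree (pair_subset he hf) (by rw [ncard_pair hef])
    have h3 : M.eRk {e, f} ≤ 2 := by
      have := M.eRk_le_encard {e, f}
      rwa [encard_pair hef] at this
    exact le_antisymm h3 h2
  have hC1 : ∀ L ⊆ M.E, M.eRk L = 2 → L.ncard ≤ 3 :=
    fun L hL hr => ncard_le_three_of_eRk_two M hs hfree hL hr
  have hcirc : ∀ C, M.IsCircuit C → 3 ≤ C.encard := three_le_encard_of_circuit M hL0 hs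
  have hs6 : {C : Set α | M.IsCircuit C ∧ C.ncard = 6}.ncard ≤ (7 + 5).choose 6 :=
    Matroid.ncard_circuits_le_choose_of_encard M hd 5
  norm_num [Nat.choose] at hs6
  have hEfin := M.ground_finite
  have cellA : ∀ (U S m : ℕ) (A : ℚ), Matroid.topCount M 11 5 ≤ U →
      {X : Set α | X ⊆ M.E ∧ M.eRk X = M.eRank}.ncard ≤ S → m ≤ 1024 →
      1024 * (U : ℚ) ≤ ((1024 - m : ℕ) : ℚ) * 2 ^ (7 - 5) * (12107 : ℚ) →
      (1024 : ℚ) * (A + (S : ℚ)) ≤ (m : ℚ) * 2 ^ 18 →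
      ({X : Set α | X ⊆ M.E ∧ M.eRk X ≤ 5}.ncard : ℚ) ≤ A →
      ((phiK 13 5 - 6) / 4) * (Matroid.topCount M 11 5 : ℚ) ≤ (Matroid.midCount M 11 5 : ℚ) := by
    intro U S m A hU hS hm hpoly htail hA
    exact c025_core_five_cell_of_counts_xqictq5g M 11 7 (by norm_num) hR hn U hU _ hA S hS
      12107 (by norm_num) ((phiK 13 5 - 6) / 4) (by rw [phiK_thirteen_five]; norm_num) ⟨m, hm, hpoly, htail⟩
  -- the top count through the top `5`- and `6`-sets
  have hUsum := S2.topCount_mul_five_le_seven M hR hd hC1 hflat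
  have htop5 : {B : Set α | B ⊆ M.E ∧ B.ncard = 5 ∧ M.eRk B = 5 ∧ M.eRk (M.E \ B) = M.eRank}.ncard ≤
      {B : Set α | B ⊆ M.E ∧ B.ncard = 5 ∧ M.eRk B = 5}.ncard :=
    Set.ncard_le_ncard (fun B hB => ⟨hB.1, hB.2.1, hB.2.2.1⟩) (hEfin.finite_subsets.subset (fun B hB => hB.1))
  have hind5 := S2.ncard_indep_five_add_le (M := M) hC1
  rw [hn] at hind5
  norm_num [Nat.choose] at hind5
  have htop6 : {B : Set α | B ⊆ M.E ∧ B.ncard = 6 ∧ M.eRk B = 5 ∧ M.eRk (M.E \ B) = M.eRank}.ncard ≤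
      {C : Set α | M.IsCircuit C ∧ C.ncard = 3}.ncard * 455 + 69 * 91 + 401 * 13 + 924 := by
    have hc455 : ∀ T : Set α, M.IsCircuit T → T.ncard = 3 →
        {B : Set α | B ⊆ M.E ∧ B.ncard = 6 ∧ T ⊆ B ∧ M.eRk (M.E \ B) = M.eRank}.ncard ≤ 455 := by
      intro T hT hT3
      have hsub : {B : Set α | B ⊆ M.E ∧ B.ncard = 6 ∧ T ⊆ B ∧ M.eRk (M.E \ B) = M.eRank} ⊆
          {X : Set α | X ⊆ M.E ∧ X.ncard = 6 ∧ T ⊆ X} := fun B hB => ⟨hB.1, hB.2.1, hB.2.2.1⟩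
      have h := (Set.ncard_le_ncard hsub (hEfin.finite_subsets.subset (fun X hX => hX.1))).trans
        (S2.ncard_subsets_superset_le M hT.subset_ground 6)
      rw [hn, hT3] at h
      norm_num [Nat.choose] at h
      exact h
    have := S2.ncard_top_six_le_n M hn hcirc 455 hc455
    norm_num [Nat.choose] at this
    have h5' := Nat.mul_le_mul_right 13 hs5
    have h4' := Nat.mul_le_mul_right 91 hs4c
    omega
  -- the spanning count (the kit) and the tail at `t ≤ 2`
  have hS' : {X : Set α | X ⊆ M.E ∧ M.eRk X = M.eRank}.ncard ≤ 63004 := by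
    have hS := Matroid.ncard_spanning_le (M := M) hd
    rw [hEcard] at hS
    exact hS.trans (by decide)
  have hA := ncard_eRk_le_five_le_spread M 11 7 (by norm_num) hR hn hfree hflat hflat' 2 69 401 ht2 hs4c hs5
  obtain ⟨t, ht⟩ : ∃ t, {C : Set α | M.IsCircuit C ∧ C.ncard = 3}.ncard = t := ⟨_, rfl⟩
  rw [ht] at ht2 htop6 hind5
  have hU' : Matroid.topCount M 11 5 ≤ 27015 := by
    interval_cases t <;> norm_num [Nat.choose] at hind5 htop6 <;> omega
  exact cellA _ 63004 404 _ hU' hS' (by norm_num) (by norm_num) (by norm_num [Nat.choose]) hA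

/-- **The rows `3 ≤ t ≤ 8` of the spread case of the twice-scaled cell `(11, 7)` at `K₂`.** -/
theorem c025_eleven_seven_k2_spread_three_to_eight (M : Matroid α) [M.Finite]
    (hR : M.eRank = ((11 : ℕ) : ℕ∞)) (hn : M.E.ncard = 11 + 7)
    (hfree : ∀ e ∈ M.E, ∃ A ⊆ M.E \ {e}, e ∉ M.closure A ∧ e ∉ M.closure ((M.E \ {e}) \ A))
    (h4 : ¬ ∃ W ⊆ M.E, W.ncard ≤ 9 ∧ W.encard = M.eRk W + 4)
    (ht3 : 3 ≤ {C : Set α | M.IsCircuit C ∧ C.ncard = 3}.ncard)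
    (ht8 : {C : Set α | M.IsCircuit C ∧ C.ncard = 3}.ncard ≤ 8) :
    ((phiK 13 5 - 6) / 4) * (Matroid.topCount M 11 5 : ℚ) ≤ (Matroid.midCount M 11 5 : ℚ) := by
  classical
  have hd : M.E.encard = M.eRank + ((7 : ℕ) : ℕ∞) := by
    rw [hR, ← M.ground_finite.cast_ncard_eq, hn]
    push_cast
    ring
  obtain ⟨-, hs4c, hs5⟩ := caps_eleven_seven M hd hfree
  have hflat : ∀ X ⊆ M.E, M.eRk X ≤ 5 → X.ncard ≤ 8 := fun X hX hr => by
    have := S2.ncard_le_of_eRk_le_of_not_nullity M 4 9 (by norm_num) h4 hX (r := 5) (by norm_num) (by exact_mod_cast hr)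
    omega
  have hflat' : ∀ X ⊆ M.E, M.eRk X ≤ 4 → X.ncard ≤ 7 := fun X hX hr => by
    have := S2.ncard_le_of_eRk_le_of_not_nullity M 4 9 (by norm_num) h4 hX (r := 4) (by norm_num) (by exact_mod_cast hr)
    omega
  have hL0 : ∀ e ∈ M.E, ¬ M.IsLoop e := not_isLoop_of_free M hfree
  have hs : ∀ e ∈ M.E, ∀ f ∈ M.E, e ≠ f → M.eRk {e, f} = 2 := by
    intro e he f hf hef
    have h2 : (2 : ℕ∞) ≤ M.eRk {e, f} :=
      two_le_eRk_of_two_le_ncard_of_free M hfree (pair_subset he hf) (by rw [ncard_pair hef])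
    have h3 : M.eRk {e, f} ≤ 2 := by
      have := M.eRk_le_encard {e, f}
      rwa [encard_pair hef] at this
    exact le_antisymm h3 h2
  have hC1 : ∀ L ⊆ M.E, M.eRk L = 2 → L.ncard ≤ 3 :=
    fun L hL hr => ncard_le_three_of_eRk_two M hs hfree hL hr
  have hcirc : ∀ C, M.IsCircuit C → 3 ≤ C.encard := three_le_encard_of_circuit M hL0 hs
  have hTfin : {C : Set α | M.IsCircuit C ∧ C.ncard = 3}.Finite :=
    M.ground_finite.finite_subsets.subset (fun C hC => hC.1.subset_ground)
  have hs6 : {C : Set α | M.IsCircuit C ∧ C.ncard = 6}.ncard ≤ (7 + 5).choose 6 :=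
    Matroid.ncard_circuits_le_choose_of_encard M hd 5
  norm_num [Nat.choose] at hs6
  have hEfin := M.ground_finite
  have cellA : ∀ (U S m : ℕ) (A : ℚ), Matroid.topCount M 11 5 ≤ U →
      {X : Set α | X ⊆ M.E ∧ M.eRk X = M.eRank}.ncard ≤ S → m ≤ 1024 →
      1024 * (U : ℚ) ≤ ((1024 - m : ℕ) : ℚ) * 2 ^ (7 - 5) * (12107 : ℚ) →
      (1024 : ℚ) * (A + (S : ℚ)) ≤ (m : ℚ) * 2 ^ 18 →
      ({X : Set α | X ⊆ M.E ∧ M.eRk X ≤ 5}.ncard : ℚ) ≤ A →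
      ((phiK 13 5 - 6) / 4) * (Matroid.topCount M 11 5 : ℚ) ≤ (Matroid.midCount M 11 5 : ℚ) := by
    intro U S m A hU hS hm hpoly htail hA
    exact c025_core_five_cell_of_counts_xqictq5g M 11 7 (by norm_num) hR hn U hU _ hA S hS
      12107 (by norm_num) ((phiK 13 5 - 6) / 4) (by rw [phiK_thirteen_five]; norm_num) ⟨m, hm, hpoly, htail⟩
  have hUsum := S2.topCount_mul_five_le_seven M hR hd hC1 hflat
  have htop5' : {B : Set α | B ⊆ M.E ∧ B.ncard = 5 ∧ M.eRk B = 5 ∧ M.eRk (M.E \ B) = M.eRank}.ncard ≤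
      {B : Set α | B ⊆ M.E ∧ B.ncard = 5 ∧ M.eRk B = 5}.ncard :=
    Set.ncard_le_ncard (fun B hB => ⟨hB.1, hB.2.1, hB.2.2.1⟩) (hEfin.finite_subsets.subset (fun B hB => hB.1))
  have hind5 := S2.ncard_indep_five_add_le (M := M) hC1
  rw [hn] at hind5
  norm_num [Nat.choose] at hind5
  have htop6 : {B : Set α | B ⊆ M.E ∧ B.ncard = 6 ∧ M.eRk B = 5 ∧ M.eRk (M.E \ B) = M.eRank}.ncard ≤
      {C : Set α | M.IsCircuit C ∧ C.ncard = 3}.ncard * 455 + 69 * 91 + 401 * 13 + 924 := by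
    have hc455 : ∀ T : Set α, M.IsCircuit T → T.ncard = 3 →
        {B : Set α | B ⊆ M.E ∧ B.ncard = 6 ∧ T ⊆ B ∧ M.eRk (M.E \ B) = M.eRank}.ncard ≤ 455 := by
      intro T hT hT3
      have hsub : {B : Set α | B ⊆ M.E ∧ B.ncard = 6 ∧ T ⊆ B ∧ M.eRk (M.E \ B) = M.eRank} ⊆
          {X : Set α | X ⊆ M.E ∧ X.ncard = 6 ∧ T ⊆ X} := fun B hB => ⟨hB.1, hB.2.1, hB.2.2.1⟩
      have h := (Set.ncard_le_ncard hsub (hEfin.finite_subsets.subset (fun X hX => hX.1))).trans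
        (S2.ncard_subsets_superset_le M hT.subset_ground 6)
      rw [hn, hT3] at h
      norm_num [Nat.choose] at h
      exact h
    have := S2.ncard_top_six_le_n M hn hcirc 455 hc455
    norm_num [Nat.choose] at this
    have h5' := Nat.mul_le_mul_right 13 hs5
    have h4' := Nat.mul_le_mul_right 91 hs4c
    omega
  -- three triangles: the spanning count; the tail at `t ≤ 8`
  obtain ⟨T₁, T₂, T₃, hT₁, hT₂, hT₃, h12, h13, h23⟩ := (Set.two_lt_ncard_iff hTfin).1 (by omega)
  have hS' : {X : Set α | X ⊆ M.E ∧ M.eRk X = M.eRank}.ncard ≤ 48847 := by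
    have hS := S2.ncard_spanning_add_le_of_three_triangles M hR hn (by norm_num) hC1 hT₁.1 hT₁.2 hT₂.1 hT₂.2
      hT₃.1 hT₃.2 h12 h13 h23
    norm_num [Finset.sum_range_succ, Nat.choose] at hS
    omega
  have hA := ncard_eRk_le_five_le_spread M 11 7 (by norm_num) hR hn hfree hflat hflat' 8 69 401 ht8 hs4c hs5
  -- the top `5`-sets: four triangles at `t ≥ 4`, the independent `5`-sets at `t = 3`
  have hU' : Matroid.topCount M 11 5 ≤ 30206 := by
    by_cases ht4 : 4 ≤ {C : Set α | M.IsCircuit C ∧ C.ncard = 3}.ncard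
    · obtain ⟨T₁, T₂, T₃, T₄, hT₁, hT₂, hT₃, hT₄, h12, h13, h14, h23, h24, h34⟩ :=
        (Set.three_lt_ncard_iff hTfin).1 (by omega)
      have htop5 := S2.ncard_top_five_le_of_four_triangles_eighteen M hR hn hC1 hT₁ hT₂ hT₃ hT₄ h12 h13 h14 h23 h24 h34
      omega
    · have ht3' : {C : Set α | M.IsCircuit C ∧ C.ncard = 3}.ncard = 3 := by omega
      rw [ht3'] at hind5 htop6
      norm_num [Nat.choose] at hind5
      omega
  exact cellA _ 48847 368 _ hU' hS' (by norm_num) (by norm_num) (by norm_num [Nat.choose]) hA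

end ThmN

end PercRepro
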